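import Summits.MatrixMultiplication.OmegaCensus.STPPSmallPatternKernelSearchX2

/-!
# ω-census, `(2,1,1)^6` is infeasible in `ℤ/26` — kernel search, part 6 of 18

HONEST FRAMING (pub-omega census; verbatim): lottery ticket; floor = certified bounds/negative ranges.
Census STRUCTURE bookkeeping of the STPP track (seat pub-omega-eng2 = ENG2, gen 33, on the kernel engine + reflection of seat
pub-omega-stpp-3 gen 23; STRUCTURE row B5, the threshold column `T1(H) = max {k : (2,1,1)^k ⊆ H}`, lower side of the
`k = 6` ORDER LAW `(2,1,1)⁶ ⊆ G ↔ 30 ≤ |G|`), not progress on `ω`: small patterns in small groups bound no exponent.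

Chunks of the kernel mask search `STPP211Neg.search2 (zcode 26) 6` (`decide +kernel`; ≈ 136 s of kernel time predicted);
assembled in `STPPSmallPatternNone211K6Z26.lean`.  Chunk entries `(d, x1, x2)`: representative `d` of `A₀ = {0, d}`, FIRST-level exclusion mask `x1`, SECOND-level exclusion mask `x2` (`STPPSmallPatternKernelSearchX2.lean`).

References: H. Cohn, R. Kleinberg, B. Szegedy, C. Umans, FOCS 2005 (arXiv:math/0511460), Def. 5.1.  Record: pub-omega HOME
`pub-omega-eng2-g33/results/none6/` (ENG2's C mirror `k211c.c` of the kernel tree — validated against stpp-3's Python mirror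
`k211v3.py` on the landed `k = 5` cells to the translation count — gives COMPLETE NONE on this cell with 70061185 mask
translations; per-`(d,c₁,c₂)` cost tables, planner `plan6.py`; farm calibration 46 µs per translation; not used by the proofs).
-/

set_option Elab.async false  -- several kernel pieces: elaborate sequentially (memory)

namespace Summit.MatrixMultiplication.OmegaCensus

namespace STPP211Neg

/-- Chunk list 12 of `ℤ/26`, `k = 6` (1959570 mask translations in the mirror ≈ 90 s predicted). -/
def Z26k6.ch12 : List (ℕ × ℕ × ℕ) :=
  [(1, 67080191, 0)]

/-- Kernel search over chunk list 12 of `ℤ/26`, `k = 6`. -/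
theorem Z26k6.s12 : search2 (zcode 26) 6 Z26k6.ch12 = true := by
  decide +kernel

/-- Chunk list 13 of `ℤ/26`, `k = 6` (1006274 mask translations in the mirror ≈ 46 s predicted). -/
def Z26k6.ch13 : List (ℕ × ℕ × ℕ) :=
  [(1, 32767, 0)]

/-- Kernel search over chunk list 13 of `ℤ/26`, `k = 6`. -/
theorem Z26k6.s13 : search2 (zcode 26) 6 Z26k6.ch13 = true := by
  decide +kernel

/-- The chunk lists of this part, concatenated. -/
def Z26k6.part6 : List (ℕ × ℕ × ℕ) :=
  Z26k6.ch12 ++ Z26k6.ch13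

/-- The kernel search over this part's chunks (assembled). -/
theorem Z26k6.ps6 : search2 (zcode 26) 6 Z26k6.part6 = true := by
  simp only [Z26k6.part6, search2_append, Z26k6.s12, Z26k6.s13, Bool.and_self]

end STPP211Neg

end Summit.MatrixMultiplication.OmegaCensus
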